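import Summits.Ventures.HSemireg.WedgeHankelSubstitutionSemisimpleCentralizer
import Summits.Ventures.HSemireg.WedgeHankelSubstitutionSemisimpleDegree

/-!
# Venture HSemireg — EIGENVALUE MULTIPLICITIES OF A SPLIT SEMISIMPLE SUBSTITUTION AS RESIDUE-CLASS COUNTS: with non-zero weights `a^{n−p}b^p = a^n r^p` the multiplicity of
# the weight of `p` is `#{p′ ≤ n : p′ ≡ p (mod ord r)}` (`r = b/a`), so the spectrum is simple iff `ord r = 0 ∨ n < ord r`, and `dim Centralizer = Σ_p #{p′ ≡ p (mod ord r)}`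

HONEST FRAMING. Part of the Lean index of the computation cell `pub-hsemireg` (seat p10 gen 22, Sunday typer «UNIFORM-IN-n»).
Finite-dimensional EXTERIOR ALGEBRA + linear algebra + elementary group theory ONLY: no variety, no cohomology theory, no sheaf, no Ext group, no semiregularity map;
nothing here says that HC / HC_CM / HC_AV holds; no Literature fact is declared or used.  Custodian versions as in `WedgeHankelSiegelIdeal` (1/3) and `WedgeHankelFrameChange`;
the dictionary (weight multiplicities of `Sym^n(g)` for split semisimple `g` = residue classes of the exponent modulo the order of the eigenvalue ratio) is QUOTED, never asserted.

WHAT IS IN THE TREE.  K18 (`…SemisimpleEigenspaces`): `finrank_eigenspace_SbC_of_fixed_two` (`dim E_m = #{p : w_p = m}`), `finrank_eigenspace_SbC_diag`; K23 (`…SemisimpleCentralizer`):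
`finrank_centralizer_SbC_of_fixed_two` (`Σ_p #{p′ : w_{p′} = w_p}`); K26 (`…SemisimpleDegree`): `weight_eq_pow_mul_ratio_pow` (`a^{n−p}b^p = a^n r^p`), `weights_injective_iff`; K12
(`…TorusOrder`): `pow_eq_pow_iff_modEq_orderOf` (`t^a = t^b ⇔ a ≡ b (mod ord t)`).  THIS FILE (namespace `Summit.Ventures.HSemireg.Wedge.HankelFrameChange` continued; imports K23, K26):
* §338 `weight_eq_weight_iff_modEq` (`w_{p′} = w_p ⇔ p′ ≡ p (mod ord r)`, `a, b ≠ 0`), **`card_filter_weight_eq_eq_card_filter_modEq`** (`#{p′ : w_{p′} = w_p} = #{p′ ≤ n : p′ ≡ p (mod ord r)}`),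
  `card_filter_modEq_eq_one_of_orderOf_eq_zero` / `_of_lt_orderOf` (the class of `p` in `[0, n]` is `{p}` when `ord r = 0` or `n < ord r`).
* §339 **`finrank_eigenspace_SbC_weight_of_fixed_two`** (`dim E_{w_p} = #{p′ ≤ n : p′ ≡ p (mod ord r)}`, two distinct fixed nodes, non-zero weights),
  **`finrank_eigenspace_SbC_weight_eq_one_of_fixed_two`** (simple spectrum when `ord r = 0 ∨ n < ord r`), `finrank_eigenspace_SbC_diag_weight` / `…_torus_weight` (`SbC(1 0 0 t)`:
  `dim E_{t^p} = #{p′ ≡ p (mod ord t)}`), **`finrank_centralizer_SbC_of_fixed_two_eq_sum_card_modEq`** (`dim Centralizer = Σ_p #{p′ ≡ p (mod ord r)}`), `finrank_centralizer_SbC_torus_eq_sum`.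
NOT typed here: the closed form `⌊(n − p mod d)/d⌋ + 1` of the residue count (Mathlib `Nat.Ico_filter_modEq_card` gives a `⌈·⌉` form over `ℚ`), non-split `g`; anything Ext-side.
New names only.
-/

open Module

namespace Summit.Ventures.HSemireg.Wedge.HankelFrameChange

open Summit.Ventures.HSemireg.Wedge Summit.Ventures.HSemireg.Wedge.Kunneth Summit.Ventures.HSemireg.Wedge.Hankel
  Summit.Ventures.HSemireg.Wedge.BasisFree Summit.Ventures.HSemireg.Wedge.HankelSiegel Summit.Ventures.HSemireg.Wedge.HankelSiegelIdeal
  Summit.Ventures.HSemireg.Wedge.KunnethKernel Summit.Ventures.HSemireg.Wedge.HankelRankOne Summit.Ventures.HSemireg.Wedge.KernelDuality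

variable (K : Type*) [Field K] {n : ℕ}

/-! ## §338. Equal weights ⇔ congruent exponents -/

/-- **`a^{n−p′}b^{p′} = a^{n−p}b^p ⇔ p′ ≡ p (mod ord(b/a))`** (`a, b ≠ 0`). -/
theorem weight_eq_weight_iff_modEq {a b : K} (ha : a ≠ 0) (hb : b ≠ 0) (p p' : Fin (n + 1)) :
    a ^ (n - (p' : ℕ)) * b ^ (p' : ℕ) = a ^ (n - (p : ℕ)) * b ^ (p : ℕ) ↔ (p' : ℕ) ≡ (p : ℕ) [MOD orderOf (b / a)] := by
  rw [weight_eq_pow_mul_ratio_pow K ha b p, weight_eq_pow_mul_ratio_pow K ha b p', mul_right_inj' (pow_ne_zero n ha), pow_eq_pow_iff_modEq_orderOf K (div_ne_zero hb ha)]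

open Classical in
/-- **the multiplicity count is a residue-class count: `#{p′ : w_{p′} = w_p} = #{p′ ≤ n : p′ ≡ p (mod ord(b/a))}`.** -/
theorem card_filter_weight_eq_eq_card_filter_modEq {a b : K} (ha : a ≠ 0) (hb : b ≠ 0) (p : Fin (n + 1)) :
    (Finset.univ.filter fun p' : Fin (n + 1) => a ^ (n - (p' : ℕ)) * b ^ (p' : ℕ) = a ^ (n - (p : ℕ)) * b ^ (p : ℕ)).card =
      (Finset.univ.filter fun p' : Fin (n + 1) => (p' : ℕ) ≡ (p : ℕ) [MOD orderOf (b / a)]).card :=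
  congrArg Finset.card (Finset.filter_congr fun p' _ => weight_eq_weight_iff_modEq K ha hb p p')

omit [Field K] in
/-- `d = 0`: congruence modulo `0` is equality, so the class of `p` in `[0, n]` is `{p}`. -/
theorem card_filter_modEq_eq_one_of_eq_zero {d : ℕ} (hd : d = 0) (p : Fin (n + 1)) :
    (Finset.univ.filter fun p' : Fin (n + 1) => (p' : ℕ) ≡ (p : ℕ) [MOD d]).card = 1 := by
  rw [Finset.card_eq_one]
  refine ⟨p, Finset.ext fun p' => ?_⟩
  rw [Finset.mem_filter, Finset.mem_singleton, hd, Nat.modEq_zero_iff]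
  exact ⟨fun h => Fin.ext h.2, fun h => ⟨Finset.mem_univ _, by rw [h]⟩⟩

omit [Field K] in
/-- `n < d`: two exponents `≤ n` congruent modulo `d` are equal, so the class of `p` in `[0, n]` is `{p}`. -/
theorem card_filter_modEq_eq_one_of_lt {d : ℕ} (hd : n < d) (p : Fin (n + 1)) :
    (Finset.univ.filter fun p' : Fin (n + 1) => (p' : ℕ) ≡ (p : ℕ) [MOD d]).card = 1 := by
  rw [Finset.card_eq_one]
  refine ⟨p, Finset.ext fun p' => ?_⟩
  rw [Finset.mem_filter, Finset.mem_singleton]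
  constructor
  · rintro ⟨-, h⟩
    have h1 := Nat.mod_eq_of_lt (lt_of_le_of_lt (Nat.le_of_lt_succ p'.2) hd)
    have h2 := Nat.mod_eq_of_lt (lt_of_le_of_lt (Nat.le_of_lt_succ p.2) hd)
    unfold Nat.ModEq at h
    rw [h1, h2] at h
    exact Fin.ext h
  · intro h; exact ⟨Finset.mem_univ _, by rw [h]⟩

omit [Field K] in
/-- the residue classes partition `[0, n]`: `Σ_p #{p′ ≡ p} = Σ over classes of (size)²` — recorded as the plain identity `Σ_{p} 1_{p′ ≡ p} = #{p′ ≡ p}` summed; here only the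
trivial bound `#{p′ ≡ p} ≥ 1` (the class contains `p`). -/
theorem one_le_card_filter_modEq (d : ℕ) (p : Fin (n + 1)) : 1 ≤ (Finset.univ.filter fun p' : Fin (n + 1) => (p' : ℕ) ≡ (p : ℕ) [MOD d]).card :=
  Finset.card_pos.mpr ⟨p, Finset.mem_filter.mpr ⟨Finset.mem_univ _, Nat.ModEq.refl _⟩⟩

/-! ## §339. Eigenvalue multiplicities and the centralizer through residue classes -/

open Classical in
/-- **TWO DISTINCT FIXED NODES, NON-ZERO WEIGHTS: the multiplicity of the weight of `p` is `#{p′ ≤ n : p′ ≡ p (mod ord r)}`**, `r = (α+λ₂γ)/(α+λ₁γ)` (K18 + §338). -/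
theorem finrank_eigenspace_SbC_weight_of_fixed_two {α β γ δ l₁ l₂ : K} (h₁₂ : l₁ ≠ l₂) (e₁ : β + l₁ * δ = l₁ * (α + l₁ * γ)) (e₂ : β + l₂ * δ = l₂ * (α + l₂ * γ))
    (ha : α + l₁ * γ ≠ 0) (hb : α + l₂ * γ ≠ 0) (p : Fin (n + 1)) :
    finrank K ↥(Module.End.eigenspace (SbC K α β γ δ (n := n)) ((α + l₁ * γ) ^ (n - (p : ℕ)) * (α + l₂ * γ) ^ (p : ℕ))) =
      (Finset.univ.filter fun p' : Fin (n + 1) => (p' : ℕ) ≡ (p : ℕ) [MOD orderOf ((α + l₂ * γ) / (α + l₁ * γ))]).card := by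
  rw [finrank_eigenspace_SbC_of_fixed_two K h₁₂ e₁ e₂, card_filter_weight_eq_eq_card_filter_modEq K ha hb p]

/-- **SIMPLE SPECTRUM: every weight has multiplicity one when `ord r = 0 ∨ n < ord r`** (two distinct fixed nodes, non-zero weights; K26 `weights_injective_iff`). -/
theorem finrank_eigenspace_SbC_weight_eq_one_of_fixed_two {α β γ δ l₁ l₂ : K} (h₁₂ : l₁ ≠ l₂) (e₁ : β + l₁ * δ = l₁ * (α + l₁ * γ)) (e₂ : β + l₂ * δ = l₂ * (α + l₂ * γ))
    (ha : α + l₁ * γ ≠ 0) (hb : α + l₂ * γ ≠ 0) (hord : orderOf ((α + l₂ * γ) / (α + l₁ * γ)) = 0 ∨ n < orderOf ((α + l₂ * γ) / (α + l₁ * γ))) (p : Fin (n + 1)) :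
    finrank K ↥(Module.End.eigenspace (SbC K α β γ δ (n := n)) ((α + l₁ * γ) ^ (n - (p : ℕ)) * (α + l₂ * γ) ^ (p : ℕ))) = 1 := by
  classical
  rw [finrank_eigenspace_SbC_weight_of_fixed_two K h₁₂ e₁ e₂ ha hb p]
  rcases hord with h0 | hlt
  · exact card_filter_modEq_eq_one_of_eq_zero h0 p
  · exact card_filter_modEq_eq_one_of_lt hlt p

open Classical in
/-- the diagonal torus `SbC(a 0 0 d)` (`a, d ≠ 0`): `dim E_{a^{n−p}d^p} = #{p′ ≤ n : p′ ≡ p (mod ord(d/a))}`. -/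
theorem finrank_eigenspace_SbC_diag_weight {a d : K} (ha : a ≠ 0) (hd : d ≠ 0) (p : Fin (n + 1)) :
    finrank K ↥(Module.End.eigenspace (SbC K a 0 0 d (n := n)) (a ^ (n - (p : ℕ)) * d ^ (p : ℕ))) =
      (Finset.univ.filter fun p' : Fin (n + 1) => (p' : ℕ) ≡ (p : ℕ) [MOD orderOf (d / a)]).card := by
  rw [finrank_eigenspace_SbC_diag, card_filter_weight_eq_eq_card_filter_modEq K ha hd p]

open Classical in
/-- **TH-7's TORUS ELEMENT `SbC(1 0 0 t)` (`t ≠ 0`): `dim E_{t^p} = #{p′ ≤ n : p′ ≡ p (mod ord t)}`.** -/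
theorem finrank_eigenspace_SbC_torus_weight {t : K} (ht : t ≠ 0) (p : Fin (n + 1)) :
    finrank K ↥(Module.End.eigenspace (SbC K 1 0 0 t (n := n)) (t ^ (p : ℕ))) = (Finset.univ.filter fun p' : Fin (n + 1) => (p' : ℕ) ≡ (p : ℕ) [MOD orderOf t]).card := by
  have h := finrank_eigenspace_SbC_diag_weight K (n := n) one_ne_zero ht p
  rwa [one_pow, one_mul, div_one] at h

open Classical in
/-- **`dim Centralizer(SbC g) = Σ_p #{p′ ≤ n : p′ ≡ p (mod ord r)}`** (two distinct fixed nodes, non-zero weights; K23 + §338). -/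
theorem finrank_centralizer_SbC_of_fixed_two_eq_sum_card_modEq {α β γ δ l₁ l₂ : K} (h₁₂ : l₁ ≠ l₂) (e₁ : β + l₁ * δ = l₁ * (α + l₁ * γ))
    (e₂ : β + l₂ * δ = l₂ * (α + l₂ * γ)) (ha : α + l₁ * γ ≠ 0) (hb : α + l₂ * γ ≠ 0) :
    finrank K ↥(Subalgebra.centralizer K ({SbC K α β γ δ} : Set (Module.End K (spikeSpan K n)))) =
      ∑ p : Fin (n + 1), (Finset.univ.filter fun p' : Fin (n + 1) => (p' : ℕ) ≡ (p : ℕ) [MOD orderOf ((α + l₂ * γ) / (α + l₁ * γ))]).card := by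
  rw [finrank_centralizer_SbC_of_fixed_two K h₁₂ e₁ e₂]
  exact Finset.sum_congr rfl fun p _ => card_filter_weight_eq_eq_card_filter_modEq K ha hb p

open Classical in
/-- th-7's torus element `SbC(1 0 0 t)`, `t ≠ 0`: `dim Centralizer = Σ_p #{p′ ≤ n : p′ ≡ p (mod ord t)}` (`= n + 1` iff the powers `t^0, …, t^n` are distinct, K23). -/
theorem finrank_centralizer_SbC_torus_eq_sum {t : K} (ht : t ≠ 0) :
    finrank K ↥(Subalgebra.centralizer K ({SbC K 1 0 0 t} : Set (Module.End K (spikeSpan K n)))) =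
      ∑ p : Fin (n + 1), (Finset.univ.filter fun p' : Fin (n + 1) => (p' : ℕ) ≡ (p : ℕ) [MOD orderOf t]).card := by
  rw [finrank_centralizer_SbC_diag]
  refine Finset.sum_congr rfl fun p _ => ?_
  have h := card_filter_weight_eq_eq_card_filter_modEq K (n := n) (one_ne_zero) ht p
  rw [div_one] at h
  rw [← h]

end Summit.Ventures.HSemireg.Wedge.HankelFrameChange
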